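import Literature.AlgebraicGeometry.ComplexMultiplication.PureEigenblockOfCommutingEndomorphisms
import HarnessLib

/-!
# A joint eigencharacter of rational endomorphisms of `H¹` whose eigenvectors are of type `(1,0)` is never real, nor is any `Aut(ℂ)`-conjugate of it (Deligne, LNM 900, §4–§5; Voisin I, Cor. 6.12)

Family `hodge`, layer `Literature/AlgebraicGeometry/ComplexMultiplication`; THEOREMS and one auxiliary DEFINITION of
data (`Complexification.twist σ = σ ⊗ id` on `ℂ ⊗_ℚ V`); no named fact, nothing conditional (D-0026).  Companion of
`PureEigenblockOfCommutingEndomorphisms` (`not_isReal_eigenfield_embedding`: the same phenomenon for an EIGENSYSTEM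
`t : R →ₐ[ℚ] ℂ` of a commutative algebra acting on `H¹`, finite-dimensionality used).  The present form is the
hypothesis-light one: a bare FAMILY `Z : ι → End_ℚ H¹(X(ℂ); ℚ)` of rational endomorphisms (no algebra structure, no
commutativity, no finite-dimensionality) and a bare function `χ : ι → ℂ`; it is the shape met when `Z` is the inclusion
of a SET of endomorphisms (the centre of a Hecke algebra, say) and `χ` a would-be central character.

## Sources, verbatim

* P. Deligne, *Hodge cycles on abelian varieties*, LNM 900 (1982), §4 (p. 30): «`H¹_B(A) ⊗ ℂ = ⊕_σ H¹_{B,σ}`,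
  `H¹_{B,σ} = H^{1,0}_σ ⊕ H^{0,1}_σ`», complex conjugation exchanging `H^{1,0}_σ` and `H^{0,1}_{σ̄}`; §5: the set `Σ`
  of embeddings occurring in `H^{1,0}` satisfies `S = Σ ⊔ ιΣ` — no `σ` occurs in `H^{1,0}` together with `σ̄`.
* C. Voisin, *Hodge Theory and Complex Algebraic Geometry I* (2002), §6.1.3 Cor. 6.12: `H^{p,q}(X) = conj H^{q,p}(X)`
  (Hodge symmetry), in the tree as `ComplexMultiplication.isOfHodgeType_zero_one_conj` /
  `eq_zero_of_isOfHodgeType_one_zero_and_zero_one` (degree one, unconditional for smooth projective `X`).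
* P. Deligne, *Théorie de Hodge II* (1971), 2.1.4: complex conjugation of `V_ℂ = ℂ ⊗_ℚ V` acts through the first
  factor and commutes with `f ⊗ ℂ` for rational `f` (tree: `Motives.HodgeStructure.conj_baseChange`, `conj_smul`).

## What is proved (unconditional, sorry-free)

DATA: `X` smooth projective over `ℂ` of dimension `d`; `Z : ι → End_ℚ H¹(X(ℂ); ℚ)`; `χ : ι → ℂ`.  A *joint
`χ`-eigenvector* is an `x ∈ ℂ ⊗_ℚ H¹` with `(Z a ⊗ ℂ) x = χ a • x` for all `a`; types are read through
`β = ofRatClassBaseChange : ℂ ⊗_ℚ H¹ → H¹(X(ℂ); ℂ)` by the tree's `IsOfHodgeType`.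

* §1 `conj_jointEigenvector`: `conj ⊗ id` carries joint `χ`-eigenvectors to joint `χ̄`-eigenvectors.
  **`exists_ne_conj_of_pureTypeWitness`** (T1): if a non-zero joint `χ`-eigenvector exists and EVERY joint
  `χ`-eigenvector is of type `(1,0)`, then `χ a ≠ conj (χ a)` for some `a` — `χ` is not real-valued;
  contrapositive `not_pureTypeWitness_of_real`; set-indexed form `exists_ne_conj_of_pureTypeWitness_set`.
  Proof: if `χ̄ = χ` then `conj w` is again a joint `χ`-eigenvector, hence of type `(1,0)`, but it is of type `(0,1)`
  by Hodge symmetry, so `conj w = 0` and `w = 0`.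
* §2 `Complexification.twist σ = σ ⊗ id` (`σ : ℂ ≃+* ℂ`) on `ℂ ⊗_ℚ V`: `σ`-semilinear (`twist_smul`), commutes with
  `f ⊗ ℂ` for rational `f` (`twist_baseChange`), `twist σ⁻¹ ∘ twist σ = id`, `twist conj = HodgeStructure.conj`
  (`twist_starRingAut`); hence it carries joint `χ`-eigenvectors to joint `σ ∘ χ`-eigenvectors
  (`twist_jointEigenvector`): the occurring characters of a RATIONAL family form an `Aut(ℂ)`-stable set.
* §3 **`exists_ne_conj_twist_of_transportWitness`** (T1⁺): let `F` be a CM field with a CM type `Θ` and a complex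
  embedding `ι₁`.  If `χ` occurs and, for every `σ : ℂ ≃+* ℂ` with `σ⁻¹ ∘ ι₁ ∈ Θ`, every joint `σ ∘ χ`-eigenvector is
  of type `(1,0)`, then for EVERY `σ : ℂ ≃+* ℂ` some value `σ (χ a)` is non-real — the field generated by the values
  of `χ` is totally imaginary.  At `σ` with `σ⁻¹ι₁ ∈ Θ` this is T1 for `σ ∘ χ`; at the other `σ` it is T1 for
  `conj ∘ σ ∘ χ`, admissible because `(conj ∘ σ)⁻¹ ∘ ι₁ = conjugate (σ⁻¹ ∘ ι₁) ∈ Θ`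
  (`trans_starRingAut_symm_comp`, `trans_starRingAut_symm_comp_mem_of_notMem`: every complex embedding of a CM
  field intertwines complex conjugation with `c_F`, Mathlib `IsCMField.complexEmbedding_complexConj`, and
  `φ ∈ Θ ↔ φ̄ ∉ Θ`).  Set-indexed form `exists_ne_conj_twist_of_transportWitness_set`.

Deliberately NOT here: CM-ness of the value field (needs an adjoint / polarisation, see
`EigenfieldConjugationCMField`); anything about a specific family `Z` (Hecke operators live under `Summits/`).
Kernel text: cell `pub-hodgecm2`, seat `s2crux-idea-2` gen 12 (tightness lemma T1/T1⁺ of its route R-A,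
`RA-T1plus-WitnessTotallyImaginary.lean`), re-homed to `Literature` by seat `b10` gen 23; statements unchanged.

## References

* [Deligne1982HodgeCycles] P. Deligne, *Hodge cycles on abelian varieties*, LNM 900 (1982), §4, §5.
* [VoisinHodgeI2002] C. Voisin, *Hodge Theory and Complex Algebraic Geometry I* (2002), §6.1.3 Cor. 6.10–6.12.
* [DeligneHodgeII1971] P. Deligne, *Théorie de Hodge II*, Publ. Math. IHÉS 40 (1971), 2.1.4.
* [Shimura1998] G. Shimura, *Abelian Varieties with Complex Multiplication and Modular Functions* (1998), §18.1,
  §18.2 Lemma (i) (`z^{ασ} = z^{σρ}`).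
* [BourbakiAlgebraI1989] N. Bourbaki, *Algebra I, Chapters 1–3* (1989), Ch. II §5 no. 1 (extension of scalars).
-/

noncomputable section

open scoped TensorProduct
open NumberField (IsCMField)

namespace Literature.AlgebraicGeometry.ComplexMultiplication

open Literature.AlgebraicGeometry.Motives (SchemeOver IsSmoothProjective CMType bettiCohomology ComplexPoints
  ofRatClassBaseChange)
open Literature.AlgebraicGeometry.HodgeTheory (IsOfHodgeType)

variable {d : ℕ} {X : SchemeOver ℂ} {ι : Type*}

/-! ## §1 A pure-`(1,0)`-type joint eigencharacter is not real -/

/-- `conj ⊗ id` carries a joint `χ`-eigenvector of a family `Z` of RATIONAL endomorphisms of `H¹(X(ℂ); ℚ)` to a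
joint `χ̄`-eigenvector: `(Z a ⊗ ℂ)(conj x) = conj (χ a) • conj x`.
[cite: Deligne1982HodgeCycles, §4 (conjugation exchanges `H^{1,0}_σ` and `H^{0,1}_{σ̄}`)] -/
theorem conj_jointEigenvector (Z : ι → Module.End ℚ (bettiCohomology X 1)) (χ : ι → ℂ)
    {x : ℂ ⊗[ℚ] bettiCohomology X 1} (hx : ∀ a, (Z a).baseChange ℂ x = χ a • x) (a : ι) :
    (Z a).baseChange ℂ (Motives.HodgeStructure.conj x) =
      starRingEnd ℂ (χ a) • Motives.HodgeStructure.conj x := by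
  rw [← Motives.HodgeStructure.conj_baseChange, hx a, Motives.HodgeStructure.conj_smul]

/-- **A pure-`(1,0)`-type joint eigencharacter is never real (T1).**  Let `X / ℂ` be smooth projective of
dimension `d`, `Z : ι → End_ℚ H¹(X(ℂ); ℚ)` any family of rational endomorphisms and `χ : ι → ℂ`.  If some non-zero
joint `χ`-eigenvector exists in `ℂ ⊗_ℚ H¹` and EVERY joint `χ`-eigenvector is a class of Hodge type `(1,0)`, then
`χ a ≠ conj (χ a)` for some `a`.  (Deligne: no embedding occurs in `H^{1,0}` together with its conjugate,
`S = Σ ⊔ ιΣ`.) [cite: Deligne1982HodgeCycles, §5] -/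
theorem exists_ne_conj_of_pureTypeWitness (hX : IsSmoothProjective d X)
    (Z : ι → Module.End ℚ (bettiCohomology X 1)) (χ : ι → ℂ)
    (hocc : ∃ w : ℂ ⊗[ℚ] bettiCohomology X 1, w ≠ 0 ∧ ∀ a, (Z a).baseChange ℂ w = χ a • w)
    (h10 : ∀ x : ℂ ⊗[ℚ] bettiCohomology X 1, (∀ a, (Z a).baseChange ℂ x = χ a • x) →
      IsOfHodgeType d X 1 1 0 (ofRatClassBaseChange (ComplexPoints X) 1 x)) :
    ∃ a, χ a ≠ starRingEnd ℂ (χ a) := by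
  by_contra! h
  obtain ⟨w, hw0, hw⟩ := hocc
  -- `conj w` is again a joint `χ`-eigenvector (`χ̄ = χ`), hence of type `(1,0)` …
  have hcw : ∀ a, (Z a).baseChange ℂ (Motives.HodgeStructure.conj w) =
      χ a • Motives.HodgeStructure.conj w := fun a ↦ by
    rw [conj_jointEigenvector Z χ hw a, ← h a]
  have h1 := h10 _ hcw
  -- … and of type `(0,1)` by Hodge symmetry, so it vanishes, and so does `w`.
  have h2 := isOfHodgeType_zero_one_conj hX (h10 w hw)
  have hz : Motives.HodgeStructure.conj w = 0 :=
    eq_zero_of_isOfHodgeType_one_zero_and_zero_one hX h1 h2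
  exact hw0 (by rw [← Motives.HodgeStructure.conj_conj w, hz, map_zero])

/-- **Contrapositive (T1′): a real-valued `χ` has no pure-`(1,0)`-type joint eigenvectors** — if
`χ a = conj (χ a)` for all `a` and every joint `χ`-eigenvector is of type `(1,0)`, then every joint
`χ`-eigenvector is zero. [cite: Deligne1982HodgeCycles, §5] -/
theorem not_pureTypeWitness_of_real (hX : IsSmoothProjective d X)
    (Z : ι → Module.End ℚ (bettiCohomology X 1)) (χ : ι → ℂ) (hreal : ∀ a, χ a = starRingEnd ℂ (χ a))
    (h10 : ∀ x : ℂ ⊗[ℚ] bettiCohomology X 1, (∀ a, (Z a).baseChange ℂ x = χ a • x) →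
      IsOfHodgeType d X 1 1 0 (ofRatClassBaseChange (ComplexPoints X) 1 x))
    {w : ℂ ⊗[ℚ] bettiCohomology X 1} (hw : ∀ a, (Z a).baseChange ℂ w = χ a • w) : w = 0 := by
  by_contra hw0
  obtain ⟨a, ha⟩ := exists_ne_conj_of_pureTypeWitness hX Z χ ⟨w, hw0, hw⟩ h10
  exact ha (hreal a)

/-- **(T1, set-indexed)**: the same for a SET `S` of rational endomorphisms of `H¹(X(ℂ); ℚ)` and `χ : ↥S → ℂ`,
read through the coercion `↥S → End_ℚ H¹`. [cite: Deligne1982HodgeCycles, §5] -/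
theorem exists_ne_conj_of_pureTypeWitness_set (hX : IsSmoothProjective d X)
    (S : Set (Module.End ℚ (bettiCohomology X 1))) (χ : ↥S → ℂ)
    (hocc : ∃ w : ℂ ⊗[ℚ] bettiCohomology X 1, w ≠ 0 ∧
      ∀ a : ↥S, (a : Module.End ℚ (bettiCohomology X 1)).baseChange ℂ w = χ a • w)
    (h10 : ∀ x : ℂ ⊗[ℚ] bettiCohomology X 1,
      (∀ a : ↥S, (a : Module.End ℚ (bettiCohomology X 1)).baseChange ℂ x = χ a • x) →
      IsOfHodgeType d X 1 1 0 (ofRatClassBaseChange (ComplexPoints X) 1 x)) :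
    ∃ a : ↥S, χ a ≠ starRingEnd ℂ (χ a) :=
  exists_ne_conj_of_pureTypeWitness hX (fun a : ↥S ↦ (a : Module.End ℚ (bettiCohomology X 1))) χ hocc h10

/-! ## §2 The `Aut(ℂ)`-twist `σ ⊗ id` of a complexification

For `σ : ℂ ≃+* ℂ` the map `twist σ = σ ⊗ id` on `ℂ ⊗_ℚ V` is `σ`-semilinear and commutes with `f ⊗ ℂ` for every
rational `f`; `twist conj` is the tree's `Motives.HodgeStructure.conj`.  Consequently the set of occurring joint
eigencharacters of a RATIONAL family of endomorphisms is stable under `χ ↦ σ ∘ χ`. -/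

namespace Complexification

variable {V W : Type*} [AddCommGroup V] [Module ℚ V] [AddCommGroup W] [Module ℚ W]

/-- The twist `σ ⊗ id : ℂ ⊗_ℚ V → ℂ ⊗_ℚ V` by a ring automorphism `σ` of `ℂ` (the `Aut(ℂ)`-action on a
complexification through the coefficients), as a `ℚ`-linear map. [folklore] -/
def twist (τ : ℂ ≃+* ℂ) : ℂ ⊗[ℚ] V →ₗ[ℚ] ℂ ⊗[ℚ] V :=
  (τ.toRingHom.toRatAlgHom.toLinearMap).rTensor V

/-- `twist τ (c ⊗ v) = τ c ⊗ v`. [cite: BourbakiAlgebraI1989, Ch. II §5 no. 1 (extension of scalars; `σ ⊗ 1` is `σ`-semilinear and natural)] -/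
@[simp]
theorem twist_tmul (τ : ℂ ≃+* ℂ) (c : ℂ) (v : V) : twist τ (c ⊗ₜ[ℚ] v) = τ c ⊗ₜ[ℚ] v := rfl

/-- `twist τ` is `τ`-semilinear: `twist τ (c • x) = τ c • twist τ x`. [cite: BourbakiAlgebraI1989, Ch. II §5 no. 1 (extension of scalars; `σ ⊗ 1` is `σ`-semilinear and natural)] -/
theorem twist_smul (τ : ℂ ≃+* ℂ) (c : ℂ) (x : ℂ ⊗[ℚ] V) : twist τ (c • x) = τ c • twist τ x := by
  induction x using TensorProduct.induction_on with
  | zero => simp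
  | tmul a v => simp [TensorProduct.smul_tmul', map_mul]
  | add x y hx hy => simp [smul_add, map_add, hx, hy]

/-- `twist τ` commutes with the base change `f ⊗ ℂ` of any `ℚ`-linear map `f`. [cite: BourbakiAlgebraI1989, Ch. II §5 no. 1 (extension of scalars; `σ ⊗ 1` is `σ`-semilinear and natural)] -/
theorem twist_baseChange (τ : ℂ ≃+* ℂ) (f : V →ₗ[ℚ] W) (x : ℂ ⊗[ℚ] V) :
    twist τ (f.baseChange ℂ x) = f.baseChange ℂ (twist τ x) := by
  induction x using TensorProduct.induction_on with
  | zero => simp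
  | tmul a v => simp
  | add x y hx hy => simp [map_add, hx, hy]

/-- `twist τ⁻¹ ∘ twist τ = id`. [cite: BourbakiAlgebraI1989, Ch. II §5 no. 1 (extension of scalars; `σ ⊗ 1` is `σ`-semilinear and natural)] -/
theorem twist_symm_twist (τ : ℂ ≃+* ℂ) (x : ℂ ⊗[ℚ] V) : twist τ.symm (twist τ x) = x := by
  induction x using TensorProduct.induction_on with
  | zero => simp
  | tmul a v => simp
  | add x y hx hy => simp [map_add, hx, hy]

/-- `twist τ` has trivial kernel. [cite: BourbakiAlgebraI1989, Ch. II §5 no. 1 (extension of scalars; `σ ⊗ 1` is `σ`-semilinear and natural)] -/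
theorem twist_ne_zero (τ : ℂ ≃+* ℂ) {x : ℂ ⊗[ℚ] V} (hx : x ≠ 0) : twist τ x ≠ 0 :=
  fun h ↦ hx (by rw [← twist_symm_twist τ x, h, map_zero])

/-- The twist by complex conjugation is the complex conjugation `conj ⊗ id` of the tree
(`Motives.HodgeStructure.conj`). [cite: DeligneHodgeII1971, 2.1.4] -/
theorem twist_starRingAut (x : ℂ ⊗[ℚ] V) : twist starRingAut x = Motives.HodgeStructure.conj x := by
  induction x using TensorProduct.induction_on with
  | zero => simp
  | tmul a v => simp [starRingAut_apply]
  | add x y hx hy => simp [map_add, hx, hy]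

/-- `twist τ` carries a joint `χ`-eigenvector of a RATIONAL family `Z` to a joint `τ ∘ χ`-eigenvector:
`(Z a ⊗ ℂ)(twist τ x) = τ (χ a) • twist τ x` (Deligne: `H¹_B ⊗ ℂ = ⊕_σ H¹_{B,σ}`, `e` acting on `H¹_{B,σ}` as
`σ(e)`; `τ ⊗ 1` carries `H¹_{B,σ}` to `H¹_{B,τσ}`). [cite: Deligne1982HodgeCycles, §4 (p. 30)] -/
theorem twist_jointEigenvector {κ : Type*} (Z : κ → Module.End ℚ V) (χ : κ → ℂ) {x : ℂ ⊗[ℚ] V}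
    (hx : ∀ a, (Z a).baseChange ℂ x = χ a • x) (τ : ℂ ≃+* ℂ) (a : κ) :
    (Z a).baseChange ℂ (twist τ x) = τ (χ a) • twist τ x := by
  rw [← twist_baseChange, hx a, twist_smul]

/-- The occurring joint eigencharacters of a rational family are `Aut(ℂ)`-stable: if `χ` has a non-zero joint
eigenvector, so does `τ ∘ χ`. [cite: Deligne1982HodgeCycles, §4 (p. 30)] -/
theorem exists_jointEigenvector_twist {κ : Type*} (Z : κ → Module.End ℚ V) (χ : κ → ℂ)
    (hocc : ∃ w : ℂ ⊗[ℚ] V, w ≠ 0 ∧ ∀ a, (Z a).baseChange ℂ w = χ a • w) (τ : ℂ ≃+* ℂ) :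
    ∃ w : ℂ ⊗[ℚ] V, w ≠ 0 ∧ ∀ a, (Z a).baseChange ℂ w = τ (χ a) • w := by
  obtain ⟨w, hw0, hw⟩ := hocc
  exact ⟨twist τ w, twist_ne_zero τ hw0, fun a ↦ twist_jointEigenvector Z χ hw τ a⟩

end Complexification

/-! ## §3 Every `Aut(ℂ)`-conjugate of a transported pure-type eigencharacter is non-real -/

/-- `(σ ≫ conj)⁻¹ ∘ ι = conjugate (σ⁻¹ ∘ ι)` for a complex embedding `ι` of a CM field `F`: every complex embedding
of `F` intertwines complex conjugation with the complex conjugation `c_F` of `F`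
(Shimura: `z^{ασ} = z^{σρ}` for every `σ ∈ J`; Mathlib `IsCMField.complexEmbedding_complexConj`).
[cite: Shimura1998, §18.2 Lemma (i)] -/
theorem trans_starRingAut_symm_comp {F : Type*} [Field F] [NumberField F] [IsCMField F] (ι₁ : F →+* ℂ)
    (σ : ℂ ≃+* ℂ) :
    (σ.trans starRingAut).symm.toRingHom.comp ι₁ =
      NumberField.ComplexEmbedding.conjugate (σ.symm.toRingHom.comp ι₁) := by
  have hτs : ∀ z, (σ.trans starRingAut).symm z = σ.symm (starRingEnd ℂ z) := fun z ↦ by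
    rw [RingEquiv.symm_apply_eq]; simp [starRingAut_apply]
  ext x
  simp only [RingHom.comp_apply, RingEquiv.toRingHom_eq_coe, RingHom.coe_coe,
    NumberField.ComplexEmbedding.conjugate_coe_eq, hτs]
  rw [← IsCMField.complexEmbedding_complexConj F ι₁ x]
  exact IsCMField.complexEmbedding_complexConj F (σ.symm.toRingHom.comp ι₁) x

/-- **CM-type complementarity under `σ ↦ σ ≫ conj`**: for a CM type `Θ` of a CM field `F` and a complex embedding
`ι₁`, if `σ⁻¹ ∘ ι₁ ∉ Θ` then `(σ ≫ conj)⁻¹ ∘ ι₁ ∈ Θ` (`φ ∉ Θ ↔ φ̄ ∈ Θ`: `Φ ⊔ Φρ` is the set of all embeddings).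
[cite: Shimura1998, §18.1] -/
theorem trans_starRingAut_symm_comp_mem_of_notMem {F : Type*} [Field F] [NumberField F] [IsCMField F]
    (Θ : CMType F) (ι₁ : F →+* ℂ) {σ : ℂ ≃+* ℂ} (hσ : σ.symm.toRingHom.comp ι₁ ∉ Θ.1) :
    (σ.trans starRingAut).symm.toRingHom.comp ι₁ ∈ Θ.1 := by
  rw [trans_starRingAut_symm_comp]
  refine (Θ.2 _).2 ?_
  have e : NumberField.ComplexEmbedding.conjugate
      (NumberField.ComplexEmbedding.conjugate (σ.symm.toRingHom.comp ι₁)) = σ.symm.toRingHom.comp ι₁ := by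
    ext x; simp
  rwa [e]

/-- **Every `Aut(ℂ)`-conjugate of a transported pure-type eigencharacter is non-real (T1⁺).**  Let `X / ℂ` be
smooth projective, `Z : ι → End_ℚ H¹(X(ℂ); ℚ)` a family of rational endomorphisms, `χ : ι → ℂ`, `F` a CM field with
a CM type `Θ` and a complex embedding `ι₁`.  If `χ` has a non-zero joint eigenvector and, for every `σ : ℂ ≃+* ℂ`
with `σ⁻¹ ∘ ι₁ ∈ Θ`, every joint `σ ∘ χ`-eigenvector is of Hodge type `(1,0)`, then for EVERY `σ : ℂ ≃+* ℂ` some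
value `σ (χ a)` is non-real: the field generated by the values of `χ` is totally imaginary.
[cite: Deligne1982HodgeCycles, §5] -/
theorem exists_ne_conj_twist_of_transportWitness (hX : IsSmoothProjective d X)
    (Z : ι → Module.End ℚ (bettiCohomology X 1)) (χ : ι → ℂ)
    {F : Type*} [Field F] [NumberField F] [IsCMField F] (Θ : CMType F) (ι₁ : F →+* ℂ)
    (hocc : ∃ w : ℂ ⊗[ℚ] bettiCohomology X 1, w ≠ 0 ∧ ∀ a, (Z a).baseChange ℂ w = χ a • w)
    (hhol : ∀ σ : ℂ ≃+* ℂ, σ.symm.toRingHom.comp ι₁ ∈ Θ.1 →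
      ∀ x : ℂ ⊗[ℚ] bettiCohomology X 1, (∀ a, (Z a).baseChange ℂ x = σ (χ a) • x) →
        IsOfHodgeType d X 1 1 0 (ofRatClassBaseChange (ComplexPoints X) 1 x))
    (σ : ℂ ≃+* ℂ) : ∃ a, σ (χ a) ≠ starRingEnd ℂ (σ (χ a)) := by
  have occ := Complexification.exists_jointEigenvector_twist Z χ hocc
  by_cases hσ : σ.symm.toRingHom.comp ι₁ ∈ Θ.1
  · exact exists_ne_conj_of_pureTypeWitness hX Z (fun a ↦ σ (χ a)) (occ σ) (hhol σ hσ)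
  · -- use `τ = σ ≫ conj`, for which `τ⁻¹ ∘ ι₁ = conjugate (σ⁻¹ ∘ ι₁) ∈ Θ`
    have hτ : ∀ y, (σ.trans starRingAut) y = starRingEnd ℂ (σ y) := fun y ↦ by
      simp [starRingAut_apply]
    obtain ⟨a, ha⟩ := exists_ne_conj_of_pureTypeWitness hX Z (fun a ↦ (σ.trans starRingAut) (χ a))
      (occ _) (hhol _ (trans_starRingAut_symm_comp_mem_of_notMem Θ ι₁ hσ))
    refine ⟨a, fun h ↦ ha ?_⟩
    simp only [hτ, starRingEnd_self_apply]
    exact h.symm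

/-- **(T1⁺, set-indexed)**: the same for a SET `S` of rational endomorphisms of `H¹(X(ℂ); ℚ)` and `χ : ↥S → ℂ`.
[cite: Deligne1982HodgeCycles, §5] -/
theorem exists_ne_conj_twist_of_transportWitness_set (hX : IsSmoothProjective d X)
    (S : Set (Module.End ℚ (bettiCohomology X 1))) (χ : ↥S → ℂ)
    {F : Type*} [Field F] [NumberField F] [IsCMField F] (Θ : CMType F) (ι₁ : F →+* ℂ)
    (hocc : ∃ w : ℂ ⊗[ℚ] bettiCohomology X 1, w ≠ 0 ∧
      ∀ a : ↥S, (a : Module.End ℚ (bettiCohomology X 1)).baseChange ℂ w = χ a • w)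
    (hhol : ∀ σ : ℂ ≃+* ℂ, σ.symm.toRingHom.comp ι₁ ∈ Θ.1 →
      ∀ x : ℂ ⊗[ℚ] bettiCohomology X 1,
        (∀ a : ↥S, (a : Module.End ℚ (bettiCohomology X 1)).baseChange ℂ x = σ (χ a) • x) →
        IsOfHodgeType d X 1 1 0 (ofRatClassBaseChange (ComplexPoints X) 1 x))
    (σ : ℂ ≃+* ℂ) : ∃ a : ↥S, σ (χ a) ≠ starRingEnd ℂ (σ (χ a)) :=
  exists_ne_conj_twist_of_transportWitness hX (fun a : ↥S ↦ (a : Module.End ℚ (bettiCohomology X 1))) χ Θ ι₁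
    hocc hhol σ

end Literature.AlgebraicGeometry.ComplexMultiplication

end
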